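import Literature.NumberTheory.LFunctions.DworkRationalityMeromorphy
import Literature.NumberTheory.LFunctions.DworkRationalityTraceFormulaProofs
import Literature.AlgebraicGeometry.Motives.ZetaFunctionProofs
import Literature.AlgebraicGeometry.Resolution.GeneralizedStabilityFiniteRankLemmas
import Mathlib.FieldTheory.Finite.Trace
import Mathlib.FieldTheory.IsAlgClosed.Basic
import HarnessLib

/-!
# Teichmüller representatives in `ℂ_p` for the algebraic closure of a finite field

Part of the proof of `Literature.NumberTheory.LFunctions.Dwork.dworkLifting` (plan in
`…/DworkRationalitySplitting.lean`). For a finite field `k` of characteristic `p` (`q = #k = pʳ`)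
we construct **Teichmüller representatives** of the elements of `k̄ = AlgebraicClosure k` in
`ℂ_p` (Koblitz, GTM 58, Ch. III §3–§4 and Ch. V §2, "Teichmüller representative"; Lang,
*Cyclotomic Fields I and II*, Ch. 14 §3, `ζ ∈ μ_{q-1}`, `ζ mod p`): a multiplicative map
`T : k̄ →* ℂ_p` with `T 0 = 0`, `‖T x‖ ≤ 1`, injective, `T x ^ {qˢ} = T x` whenever `x^{qˢ} = x`, every
`(qˢ-1)`-th root of unity of `ℂ_p` being `T x` for some `x ∈ 𝔽_{qˢ} ⊆ k̄`, and — the link between the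
`p`-adic and the finite-field trace — `∑_{i<rs} (T y)^{pⁱ} ≡ Tr_{𝔽_{qˢ}/𝔽_p}(y) (mod 𝔪)` for
`y ∈ 𝔽_{qˢ}` (`Dwork.exists_teichmuller`).

Construction: let `𝒪 = 𝓞_{ℂ_p}` with residue field `κ` (algebraically closed, of characteristic
`p`; `Literature.AlgebraicGeometry.Resolution.isAlgClosed_residueField_of_isAlgClosed`), and fix an
embedding `Φ : k̄ → κ` (`IsAlgClosed.lift` over `𝔽_p`). The *Teichmüller set*
`{ζ | ζ^{qˢ} = ζ for some s ≥ 1} = {0} ∪ ⋃ μ_{qˢ-1}` meets every residue class in at most one point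
(`Dwork.eq_of_pow_eq_of_norm_sub_lt`: for `ζ ≠ ζ'` in `μ_N`, `p ∤ N`, `‖ζ - ζ'‖ = 1`, by the geometric
sum `∑_{i<N} uⁱ ≡ N`), and, counting, in exactly one point for the classes of `{y | y^{qˢ} = y} ⊆ κ`
(`Dwork.exists_pow_eq_and_residue_eq`); `T x` is the Teichmüller point reducing to `Φ x`.

## References

* N. Koblitz, *p-adic Numbers, p-adic Analysis, and Zeta-Functions*, GTM 58 (1984), Ch. III §4
  (roots of unity in `Ω`, Teichmüller representatives), Ch. V §2. [Koblitz1984]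
* S. Lang, *Cyclotomic Fields I and II*, GTM 121 (1990), Ch. 14 §3 (Thm. 3.3: `ζ ∈ μ_{q-1}`,
  `ψ_{π,q}(ζ mod p)` with `T` the absolute trace). [Lang1990]
-/

open Finset

noncomputable section

namespace Literature.NumberTheory.LFunctions

namespace Dwork

variable {p : ℕ} [Fact p.Prime]

/-! ### The valuation ring `𝒪 = 𝓞_{ℂ_p}` and its residue field -/

/-- Membership in `𝓞_{ℂ_p}` is `‖x‖ ≤ 1`. [folklore] -/
theorem mem_padicComplexInt_iff {x : ℂ_[p]} : x ∈ 𝓞_ℂ_[p] ↔ ‖x‖ ≤ 1 := mem_unitBall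

/-- Units of `𝓞_{ℂ_p}` are the elements of norm `1`. [folklore] -/
theorem isUnit_padicComplexInt_iff (x : 𝓞_ℂ_[p]) : IsUnit x ↔ ‖(x : ℂ_[p])‖ = 1 := by
  constructor
  · rintro ⟨u, rfl⟩
    have h1 : ‖((u : 𝓞_ℂ_[p]) : ℂ_[p])‖ * ‖(((u⁻¹ : (𝓞_ℂ_[p])ˣ) : 𝓞_ℂ_[p]) : ℂ_[p])‖ = 1 := by
      rw [← norm_mul, ← MulMemClass.coe_mul, ← Units.val_mul, mul_inv_cancel, Units.val_one,
        OneMemClass.coe_one, norm_one]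
    have ha : ‖((u : 𝓞_ℂ_[p]) : ℂ_[p])‖ ≤ 1 := norm_coe_unitBall _
    have hb : ‖(((u⁻¹ : (𝓞_ℂ_[p])ˣ) : 𝓞_ℂ_[p]) : ℂ_[p])‖ ≤ 1 := norm_coe_unitBall _
    have ha0 := norm_nonneg ((u : 𝓞_ℂ_[p]) : ℂ_[p])
    exact le_antisymm ha (by nlinarith)
  · intro hx
    exact isUnit_unitBall_of_norm_eq_one hx

/-- Two elements of `𝓞_{ℂ_p}` have the same residue iff `‖x - y‖ < 1`. [folklore] -/
theorem residue_eq_residue_iff (x y : 𝓞_ℂ_[p]) :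
    IsLocalRing.residue 𝓞_ℂ_[p] x = IsLocalRing.residue 𝓞_ℂ_[p] y ↔ ‖(x : ℂ_[p]) - y‖ < 1 := by
  rw [← sub_eq_zero, ← map_sub, IsLocalRing.residue_eq_zero_iff, IsLocalRing.mem_maximalIdeal,
    mem_nonunits_iff, isUnit_padicComplexInt_iff]
  change ¬‖((x - y : 𝓞_ℂ_[p]) : ℂ_[p])‖ = 1 ↔ _
  rw [show ((x - y : 𝓞_ℂ_[p]) : ℂ_[p]) = (x : ℂ_[p]) - y from rfl]
  exact ⟨fun h => (norm_coe_unitBall (x - y)).lt_of_ne h, fun h => h.ne⟩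

/-- The residue of `x ∈ 𝓞_{ℂ_p}` vanishes iff `‖x‖ < 1`. [folklore] -/
theorem residue_eq_zero_iff' (x : 𝓞_ℂ_[p]) :
    IsLocalRing.residue 𝓞_ℂ_[p] x = 0 ↔ ‖(x : ℂ_[p])‖ < 1 := by
  rw [← map_zero (IsLocalRing.residue 𝓞_ℂ_[p]), residue_eq_residue_iff]
  simp

/-- The residue field of `𝓞_{ℂ_p}` has characteristic `p` (`‖p‖ = p⁻¹ < 1`). [folklore] -/
theorem charP_residueField : CharP (IsLocalRing.ResidueField 𝓞_ℂ_[p]) p := by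
  have hp : p.Prime := Fact.out
  have h : ((p : 𝓞_ℂ_[p]) : ℂ_[p]) = p := by simp
  have hres : IsLocalRing.residue 𝓞_ℂ_[p] (p : 𝓞_ℂ_[p]) = 0 := by
    rw [residue_eq_zero_iff', h, ← map_natCast (algebraMap ℚ_[p] ℂ_[p]) p,
      IsScalarTower.algebraMap_apply ℚ_[p] (PadicAlgCl p) ℂ_[p], ← PadicComplex.coe_eq,
      PadicComplex.norm_extends', Padic.norm_p]
    exact inv_lt_one_of_one_lt₀ (by exact_mod_cast hp.one_lt)
  rw [map_natCast] at hres
  exact ringChar.of_eq (CharP.ringChar_of_prime_eq_zero hp hres)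

/-! ### The Teichmüller set meets each residue class at most once -/

/-- `‖N‖ = 1` in `ℂ_p` for `p ∤ N`. [folklore] -/
theorem norm_natCast_eq_one_of_not_dvd {N : ℕ} (h : ¬p ∣ N) : ‖(N : ℂ_[p])‖ = 1 := by
  rw [← map_natCast (algebraMap ℚ_[p] ℂ_[p]) N, IsScalarTower.algebraMap_apply ℚ_[p] (PadicAlgCl p)
    ℂ_[p], ← PadicComplex.coe_eq, PadicComplex.norm_extends']
  refine le_antisymm (by exact_mod_cast Padic.norm_int_le_one (N : ℤ)) ?_
  by_contra hlt
  exact h (Padic.norm_natCast_lt_one_iff.mp (lt_of_not_ge hlt))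

/-- A root of unity `u` of order prime to `p` with `‖u - 1‖ < 1` is `1`: from `(u-1)∑_{i<N}uⁱ = 0` and
`∑_{i<N} uⁱ ≡ N (mod 𝔪)`, a unit (Koblitz, Ch. III §4, roots of unity of order prime to `p` are
pairwise at distance `1`). [cite: Koblitz1984, Ch. III §4] -/
theorem eq_one_of_pow_eq_one_of_norm_sub_one_lt {u : ℂ_[p]} {N : ℕ} (hN : ¬p ∣ N) (hu : u ^ N = 1)
    (h : ‖u - 1‖ < 1) : u = 1 := by
  have hN0 : N ≠ 0 := by rintro rfl; exact hN (dvd_zero p)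
  have hu1 : ‖u‖ = 1 := by
    have := congrArg norm hu
    rw [norm_pow, norm_one] at this
    exact (pow_eq_one_iff_of_nonneg (norm_nonneg u) hN0).mp this
  -- `‖uⁱ - 1‖ ≤ ‖u - 1‖`
  have hgeom : ∀ i, ‖∑ j ∈ range i, u ^ j‖ ≤ 1 := fun i =>
    IsUltrametricDist.norm_sum_le_of_forall_le_of_nonneg zero_le_one fun j _ => by
      rw [norm_pow, hu1, one_pow]
  have hpow : ∀ i, ‖u ^ i - 1‖ ≤ ‖u - 1‖ := fun i => by
    rw [← geom_sum_mul u i, norm_mul]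
    exact mul_le_of_le_one_left (norm_nonneg _) (hgeom i)
  -- `S = ∑ uⁱ` satisfies `‖S - N‖ < 1`, hence `‖S‖ = 1`
  set S := ∑ i ∈ range N, u ^ i with hS
  have hSN : ‖(N : ℂ_[p]) - S‖ < ‖(N : ℂ_[p])‖ := by
    rw [norm_natCast_eq_one_of_not_dvd hN, ← norm_neg, neg_sub]
    have : S - N = ∑ i ∈ range N, (u ^ i - 1) := by
      rw [sum_sub_distrib, sum_const, card_range, nsmul_eq_mul, mul_one]
    rw [this]
    exact lt_of_le_of_lt (IsUltrametricDist.norm_sum_le_of_forall_le_of_nonneg (norm_nonneg _)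
      fun i _ => hpow i) h
  have hS1 : ‖S‖ = 1 := by rw [norm_eq_of_norm_sub_lt' hSN, norm_natCast_eq_one_of_not_dvd hN]
  have hS0 : S ≠ 0 := fun h0 => by rw [h0, norm_zero] at hS1; exact zero_ne_one hS1
  have hprod : S * (u - 1) = 0 := by rw [hS, geom_sum_mul, hu, sub_self]
  rcases mul_eq_zero.mp hprod with h0 | h0
  · exact absurd h0 hS0
  · exact sub_eq_zero.mp h0

/-- `ζ^{m} = ζ` implies `ζ^{mᵗ} = ζ`. [folklore] -/
theorem pow_pow_eq_self_of_pow_eq_self {M : Type*} [Monoid M] {ζ : M} {m : ℕ} (h : ζ ^ m = ζ) (t : ℕ) :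
    ζ ^ m ^ t = ζ := by
  induction t with
  | zero => rw [pow_zero, pow_one]
  | succ t ih => rw [pow_succ, pow_mul, ih, h]

/-- If `ζ^E = ζ` with `E ≥ 2` then `ζ = 0` or `ζ^{E-1} = 1`, and in the latter case `‖ζ‖ = 1`. [folklore] -/
theorem eq_zero_or_pow_pred_eq_one {ζ : ℂ_[p]} {E : ℕ} (hE : 2 ≤ E) (h : ζ ^ E = ζ) :
    ζ = 0 ∨ (ζ ^ (E - 1) = 1 ∧ ‖ζ‖ = 1) := by
  by_cases h0 : ζ = 0
  · exact Or.inl h0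
  · right
    have h1 : ζ ^ (E - 1) = 1 := by
      have : ζ ^ (E - 1) * ζ = 1 * ζ := by rw [← pow_succ, Nat.sub_add_cancel (by omega), h, one_mul]
      exact mul_right_cancel₀ h0 this
    refine ⟨h1, ?_⟩
    have := congrArg norm h1
    rw [norm_pow, norm_one] at this
    exact (pow_eq_one_iff_of_nonneg (norm_nonneg ζ) (by omega)).mp this

/-- **Teichmüller points in one residue class coincide**: if `ζ^{qˢ} = ζ`, `ζ'^{q^{s'}} = ζ'`
(`s, s' ≥ 1`, `p ∣ q`) and `‖ζ - ζ'‖ < 1` then `ζ = ζ'` (Koblitz, Ch. III §4: the Teichmüller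
representative of a residue class is unique). [cite: Koblitz1984, Ch. III §4] -/
theorem eq_of_pow_eq_of_norm_sub_lt {q : ℕ} (hpq : p ∣ q) (hq : 1 < q) {ζ ζ' : ℂ_[p]} {s s' : ℕ}
    (hs : 0 < s) (hs' : 0 < s') (hζ : ζ ^ q ^ s = ζ) (hζ' : ζ' ^ q ^ s' = ζ') (h : ‖ζ - ζ'‖ < 1) :
    ζ = ζ' := by
  have hp : p.Prime := Fact.out
  -- common exponent `E = q^{s s'}`
  set E := q ^ (s * s') with hE
  have hζE : ζ ^ E = ζ := by rw [hE, pow_mul]; exact pow_pow_eq_self_of_pow_eq_self hζ s'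
  have hζ'E : ζ' ^ E = ζ' := by
    rw [hE, mul_comm, pow_mul]; exact pow_pow_eq_self_of_pow_eq_self hζ' s
  have hE2 : 2 ≤ E := by
    rw [hE]
    calc 2 ≤ q := hq
      _ = q ^ 1 := (pow_one q).symm
      _ ≤ q ^ (s * s') := Nat.pow_le_pow_right (by omega) (Nat.mul_pos hs hs')
  have hpE : p ∣ E := hpq.trans (dvd_pow_self q (Nat.mul_pos hs hs').ne')
  have hN : ¬p ∣ E - 1 := fun hd => by
    have : p ∣ E - (E - 1) := Nat.dvd_sub hpE hd
    rw [Nat.sub_sub_self (by omega)] at this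
    exact hp.not_dvd_one this
  rcases eq_zero_or_pow_pred_eq_one hE2 hζE with rfl | ⟨hζ1, hnζ⟩
  · -- `ζ = 0`: then `‖ζ'‖ < 1` forces `ζ' = 0`
    rcases eq_zero_or_pow_pred_eq_one hE2 hζ'E with rfl | ⟨-, hnζ'⟩
    · rfl
    · rw [zero_sub, norm_neg, hnζ'] at h; exact absurd h (lt_irrefl 1)
  · rcases eq_zero_or_pow_pred_eq_one hE2 hζ'E with rfl | ⟨hζ'1, -⟩
    · rw [sub_zero, hnζ] at h; exact absurd h (lt_irrefl 1)
    · -- both roots of unity: `u = ζ'/ζ` has `uᴺ = 1`, `‖u - 1‖ < 1`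
      have hζ0 : ζ ≠ 0 := fun h0 => by rw [h0, norm_zero] at hnζ; exact zero_ne_one hnζ
      have hu : (ζ' * ζ⁻¹) ^ (E - 1) = 1 := by rw [mul_pow, inv_pow, hζ1, hζ'1, inv_one, mul_one]
      have hu1 : ‖ζ' * ζ⁻¹ - 1‖ < 1 := by
        have : ζ' * ζ⁻¹ - 1 = (ζ' - ζ) * ζ⁻¹ := by field_simp
        rw [this, norm_mul, norm_inv, hnζ, inv_one, mul_one, ← norm_neg, neg_sub]
        exact h
      have := eq_one_of_pow_eq_one_of_norm_sub_one_lt hN hu hu1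
      field_simp at this
      exact this.symm

/-! ### Existence of Teichmüller lifts (counting) -/

/-- `#{y ∈ κ | y^E = y} ≤ E` in any field (`E ≥ 2`). [folklore] -/
theorem natCard_pow_eq_self_le {K : Type*} [Field K] {E : ℕ} (hE : 1 < E) :
    Nat.card {y : K // y ^ E = y} ≤ E ∧ Finite {y : K // y ^ E = y} := by
  classical
  have hne := FiniteField.X_pow_card_sub_X_ne_zero K hE
  set T : Finset K := (Polynomial.X ^ E - Polynomial.X : Polynomial K).roots.toFinset with hT
  have hmem : ∀ z : K, z ∈ T ↔ z ^ E = z := fun z => by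
    rw [hT, Multiset.mem_toFinset, Polynomial.mem_roots hne, Polynomial.IsRoot.def, Polynomial.eval_sub,
      Polynomial.eval_pow, Polynomial.eval_X, sub_eq_zero]
  have hTcard : T.card ≤ E :=
    (Multiset.toFinset_card_le _).trans
      ((Polynomial.card_roots' _).trans_eq (FiniteField.X_pow_card_sub_X_natDegree_eq K hE))
  have e : {y : K // y ^ E = y} ≃ {y : K // y ∈ T} := Equiv.subtypeEquivRight fun y => (hmem y).symm
  refine ⟨?_, Finite.of_equiv _ e.symm⟩
  rw [Nat.card_congr e, Nat.card_eq_fintype_card, Fintype.card_coe]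
  exact hTcard

/-- **Existence and uniqueness of Teichmüller lifts** (Koblitz, Ch. III §4; Ch. V §2): every
`y ∈ κ = 𝓞_{ℂ_p}/𝔪` with `y^{E} = y`, `E = qˢ ≥ 2`, `p ∣ q`, is the residue of a (unique)
`ζ ∈ 𝓞_{ℂ_p}` with `ζ^E = ζ` — i.e. `ζ = 0` or `ζ ∈ μ_{E-1}`. Counting: the `E` elements of
`{0} ∪ μ_{E-1}(ℂ_p)` have pairwise distinct residues (`eq_of_pow_eq_of_norm_sub_lt`), all roots of
`Y^E - Y`, which has at most `E` roots in the field `κ`. [cite: Koblitz1984, Ch. III §4] -/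
theorem exists_pow_eq_and_residue_eq {q : ℕ} (hpq : p ∣ q) (hq : 1 < q) {s : ℕ} (hs : 0 < s)
    (y : IsLocalRing.ResidueField 𝓞_ℂ_[p]) (hy : y ^ q ^ s = y) :
    ∃ ζ : 𝓞_ℂ_[p], (ζ : ℂ_[p]) ^ q ^ s = ζ ∧ IsLocalRing.residue 𝓞_ℂ_[p] ζ = y := by
  classical
  have hp : p.Prime := Fact.out
  set E := q ^ s with hE
  have hE1 : 1 < E := by
    rw [hE]; calc 1 < q := hq
      _ = q ^ 1 := (pow_one q).symm
      _ ≤ q ^ s := Nat.pow_le_pow_right (by omega) hs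
  set N := E - 1 with hN
  haveI : NeZero N := ⟨by omega⟩
  have hNE : N + 1 = E := by omega
  -- the candidate lifts `{0} ∪ μ_N`, indexed by `Option μ_N`
  let val : Option (rootsOfUnity N ℂ_[p]) → ℂ_[p] := fun o => o.elim 0 fun ζ => ((ζ : ℂ_[p]ˣ) : ℂ_[p])
  have hval_norm : ∀ o, ‖val o‖ ≤ 1 := by
    rintro (_ | ζ)
    · simp [val]
    · exact (norm_rootsOfUnity p ζ).le
  have hval_pow : ∀ o, val o ^ E = val o := by
    rintro (_ | ζ)
    · simp [val, zero_pow (by omega : E ≠ 0)]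
    · change ((ζ : ℂ_[p]ˣ) : ℂ_[p]) ^ E = ((ζ : ℂ_[p]ˣ) : ℂ_[p])
      have h : ((ζ : ℂ_[p]ˣ) : ℂ_[p]) ^ N = 1 := by
        rw [← Units.val_pow_eq_pow_val, (mem_rootsOfUnity N _).mp ζ.2, Units.val_one]
      rw [← hNE, pow_succ, h, one_mul]
  let lift : Option (rootsOfUnity N ℂ_[p]) → 𝓞_ℂ_[p] := fun o => ⟨val o, mem_padicComplexInt_iff.mpr (hval_norm o)⟩
  let f : Option (rootsOfUnity N ℂ_[p]) → {y : IsLocalRing.ResidueField 𝓞_ℂ_[p] // y ^ E = y} :=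
    fun o => ⟨IsLocalRing.residue 𝓞_ℂ_[p] (lift o), by
      rw [← map_pow]; congr 1; exact Subtype.ext (hval_pow o)⟩
  -- `f` is injective: distinct Teichmüller points have distinct residues
  have hinj : Function.Injective f := by
    intro o o' hoo'
    have hres : IsLocalRing.residue 𝓞_ℂ_[p] (lift o) = IsLocalRing.residue 𝓞_ℂ_[p] (lift o') :=
      congrArg Subtype.val hoo'
    rw [residue_eq_residue_iff] at hres
    have heq : val o = val o' :=
      eq_of_pow_eq_of_norm_sub_lt hpq hq hs hs (hval_pow o) (hval_pow o') hres
    rcases o with _ | ζ <;> rcases o' with _ | ζ'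
    · rfl
    · exfalso
      have h1 := norm_rootsOfUnity p ζ'
      change (0 : ℂ_[p]) = ((ζ' : ℂ_[p]ˣ) : ℂ_[p]) at heq
      rw [← heq, norm_zero] at h1; exact zero_ne_one h1
    · exfalso
      have h1 := norm_rootsOfUnity p ζ
      change ((ζ : ℂ_[p]ˣ) : ℂ_[p]) = 0 at heq
      rw [heq, norm_zero] at h1; exact zero_ne_one h1
    · exact congrArg some (Subtype.ext (Units.ext heq))
  -- counting: `#Option μ_N = E ≥ #{y | y^E = y}`
  have hcardμ : Nat.card (rootsOfUnity N ℂ_[p]) = N := HasEnoughRootsOfUnity.natCard_rootsOfUnity _ _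
  haveI : Finite (rootsOfUnity N ℂ_[p]) := Nat.finite_of_card_ne_zero (by rw [hcardμ]; exact NeZero.ne N)
  haveI : Fintype (rootsOfUnity N ℂ_[p]) := Fintype.ofFinite _
  have hcardO : Nat.card (Option (rootsOfUnity N ℂ_[p])) = E := by
    rw [Nat.card_eq_fintype_card, Fintype.card_option, ← Nat.card_eq_fintype_card, hcardμ, hNE]
  obtain ⟨hle, hfin⟩ := natCard_pow_eq_self_le (K := IsLocalRing.ResidueField 𝓞_ℂ_[p]) hE1
  haveI := hfin
  have hbij := hinj.bijective_of_nat_card_le (hcardO ▸ hle)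
  obtain ⟨o, ho⟩ := hbij.2 ⟨y, hy⟩
  exact ⟨lift o, hval_pow o, congrArg Subtype.val ho⟩

/-! ### The embedding of `k̄` into the residue field and Teichmüller representatives -/

/-- Every element of `k̄` lies in some `𝔽_{qˢ}`, `s ≥ 1`. [folklore] -/
theorem exists_pow_card_pow_eq {k : Type*} [Field k] [Finite k] (x : AlgebraicClosure k) :
    ∃ s : ℕ, 0 < s ∧ x ^ Nat.card k ^ s = x := by
  haveI := Fintype.ofFinite k
  have hint : IsIntegral k x := (Algebra.IsAlgebraic.isAlgebraic x).isIntegral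
  set K : IntermediateField k (AlgebraicClosure k) := IntermediateField.adjoin k {x} with hK
  haveI : FiniteDimensional k K := IntermediateField.adjoin.finiteDimensional hint
  haveI : Finite K := Module.finite_of_finite k
  haveI := Fintype.ofFinite K
  refine ⟨Module.finrank k K, Module.finrank_pos, ?_⟩
  have hxK : x ∈ K := IntermediateField.mem_adjoin_simple_self k x
  have hx : (⟨x, hxK⟩ : K) ^ Fintype.card K = ⟨x, hxK⟩ := FiniteField.pow_card _
  rw [Module.card_eq_pow_finrank (K := k), ← Nat.card_eq_fintype_card] at hx
  exact congrArg Subtype.val hx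

/-- The absolute trace of a finite field with `pᵐ` elements, read in the field:
`Tr_{F/𝔽_p}(y) = ∑_{i<m} y^{pⁱ}` (Mathlib `FiniteField.algebraMap_trace_eq_sum_pow` with the degree
computed from the cardinality). [folklore] -/
theorem algebraMap_trace_eq_sum_pow_of_card {F : Type*} [Field F] [Fintype F] [Algebra (ZMod p) F]
    {m : ℕ} (hcard : Fintype.card F = p ^ m) (y : F) :
    algebraMap (ZMod p) F (Algebra.trace (ZMod p) F y) = ∑ i ∈ range m, y ^ p ^ i := by
  have hp : p.Prime := Fact.out
  haveI : Fintype (ZMod p) := ZMod.fintype p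
  have h := FiniteField.algebraMap_trace_eq_sum_pow (ZMod p) F y
  have hfin : Module.finrank (ZMod p) F = m := by
    have h2 := Module.card_eq_pow_finrank (K := ZMod p) (V := F)
    rw [hcard, ZMod.card] at h2
    exact (Nat.pow_right_injective hp.two_le h2).symm
  rw [hfin, Nat.card_zmod] at h
  exact h

/-- **Teichmüller representatives** (Koblitz, GTM 58, Ch. III §4 and Ch. V §2; Lang, Ch. 14 §3). For a
finite field `k` of characteristic `p` with `q = pʳ` elements there is a multiplicative map
`T : k̄ →* ℂ_p` with: `T 0 = 0`; `‖T x‖ ≤ 1`; `T` injective; `T x^{qˢ} = T x` whenever `x^{qˢ} = x`;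
every `y ∈ ℂ_p` with `y^{qˢ-1} = 1` (`s ≥ 1`) is `T x` for some `x` with `x^{qˢ} = x`; and, for
`s ≥ 1` and `y ∈ 𝔽_{qˢ} ⊆ k̄`, the **trace congruence**
`‖∑_{i<rs} (T y)^{pⁱ} - Tr_{𝔽_{qˢ}/𝔽_p}(y)‖ < 1`, where the trace is read in `ℕ` through
`ZMod.val` (Lang, Ch. 14 §3, Thm. 3.3: `E_{π,q}(ζ) = ψ_{π,q}(ζ mod p)` with `ψ_{π,q} = ψ_π ∘ T`, `T` the
absolute trace). Construction through an embedding of `k̄` into the (algebraically closed,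
characteristic `p`) residue field of `𝓞_{ℂ_p}` and `exists_pow_eq_and_residue_eq`. [cite: Koblitz1984, Ch. III §4] [cite: Lang1990, Ch. 14 §3 Thm. 3.3] -/
theorem exists_teichmuller (k : Type*) [Field k] [Finite k] [CharP k p] {r : ℕ}
    (hr : Nat.card k = p ^ r) :
    ∃ T : AlgebraicClosure k →* ℂ_[p], T 0 = 0 ∧ (∀ x, ‖T x‖ ≤ 1) ∧ Function.Injective T ∧
      (∀ (s : ℕ) (x : AlgebraicClosure k), x ^ Nat.card k ^ s = x → T x ^ Nat.card k ^ s = T x) ∧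
      (∀ s : ℕ, 0 < s → ∀ y : ℂ_[p], y ^ (Nat.card k ^ s - 1) = 1 →
        ∃ x : AlgebraicClosure k, x ^ Nat.card k ^ s = x ∧ T x = y) ∧
      ∀ (s : ℕ) [NeZero s] [Algebra (ZMod p) (fixedField k s)] (y : fixedField k s),
        ‖∑ i ∈ range (r * s), T y ^ p ^ i -
          ((Algebra.trace (ZMod p) (fixedField k s) y).val : ℂ_[p])‖ < 1 := by
  classical
  have hp : p.Prime := Fact.out
  haveI := Fintype.ofFinite k
  set q := Nat.card k with hq
  have hq1 : 1 < q := one_lt_natCard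
  have hr0 : 0 < r := by
    rcases Nat.eq_zero_or_pos r with h | h
    · rw [h, pow_zero] at hr; rw [hr] at hq1; exact absurd hq1 (lt_irrefl 1)
    · exact h
  have hpq : p ∣ q := by rw [hr]; exact dvd_pow_self p hr0.ne'
  -- characteristic `p` everywhere, `𝔽_p`-algebra structures
  haveI hκ : CharP (IsLocalRing.ResidueField 𝓞_ℂ_[p]) p := charP_residueField
  letI : Algebra (ZMod p) k := ZMod.algebra k p
  letI : Algebra (ZMod p) (IsLocalRing.ResidueField 𝓞_ℂ_[p]) := ZMod.algebra _ p
  haveI : Algebra.IsAlgebraic (ZMod p) k := Algebra.IsAlgebraic.of_finite (ZMod p) k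
  haveI : Algebra.IsAlgebraic (ZMod p) (AlgebraicClosure k) :=
    Algebra.IsAlgebraic.trans (ZMod p) k (AlgebraicClosure k)
  haveI : IsAlgClosed (IsLocalRing.ResidueField 𝓞_ℂ_[p]) :=
    Literature.AlgebraicGeometry.Resolution.isAlgClosed_residueField_of_isAlgClosed _
  -- the embedding `Φ : k̄ → κ`
  let Φ : AlgebraicClosure k →+* IsLocalRing.ResidueField 𝓞_ℂ_[p] :=
    (IsAlgClosed.lift (R := ZMod p) (S := AlgebraicClosure k)
      (M := IsLocalRing.ResidueField 𝓞_ℂ_[p])).toRingHom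
  have hΦinj : Function.Injective Φ := Φ.injective
  -- Teichmüller lift of `Φ x`
  have H : ∀ x : AlgebraicClosure k, ∃ ζ : 𝓞_ℂ_[p],
      (∃ s, 0 < s ∧ (ζ : ℂ_[p]) ^ q ^ s = ζ) ∧ IsLocalRing.residue 𝓞_ℂ_[p] ζ = Φ x := by
    intro x
    obtain ⟨s, hs, hx⟩ := exists_pow_card_pow_eq (k := k) x
    have hy : Φ x ^ q ^ s = Φ x := by rw [← map_pow, hx]
    obtain ⟨ζ, hζ, hres⟩ := exists_pow_eq_and_residue_eq hpq hq1 hs (Φ x) hy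
    exact ⟨ζ, ⟨s, hs, hζ⟩, hres⟩
  choose T' hT'mem hT'res using H
  -- uniqueness transfers identities from `κ` to `ℂ_p`
  have huniq : ∀ {ζ ζ' : 𝓞_ℂ_[p]}, (∃ s, 0 < s ∧ (ζ : ℂ_[p]) ^ q ^ s = ζ) →
      (∃ s, 0 < s ∧ (ζ' : ℂ_[p]) ^ q ^ s = ζ') →
      IsLocalRing.residue 𝓞_ℂ_[p] ζ = IsLocalRing.residue 𝓞_ℂ_[p] ζ' → (ζ : ℂ_[p]) = ζ' := by
    rintro ζ ζ' ⟨s, hs, hζ⟩ ⟨s', hs', hζ'⟩ hres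
    exact eq_of_pow_eq_of_norm_sub_lt hpq hq1 hs hs' hζ hζ' ((residue_eq_residue_iff _ _).mp hres)
  -- the Teichmüller set is closed under products and powers
  have hmul_mem : ∀ x y : AlgebraicClosure k, ∃ s, 0 < s ∧
      ((T' x * T' y : 𝓞_ℂ_[p]) : ℂ_[p]) ^ q ^ s = (T' x * T' y : 𝓞_ℂ_[p]) := by
    intro x y
    obtain ⟨a, ha, hxa⟩ := hT'mem x
    obtain ⟨b, hb, hyb⟩ := hT'mem y
    refine ⟨a * b, Nat.mul_pos ha hb, ?_⟩
    have e1 : (T' x : ℂ_[p]) ^ q ^ (a * b) = T' x := by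
      rw [pow_mul]; exact pow_pow_eq_self_of_pow_eq_self hxa b
    have e2 : (T' y : ℂ_[p]) ^ q ^ (a * b) = T' y := by
      rw [mul_comm, pow_mul]; exact pow_pow_eq_self_of_pow_eq_self hyb a
    change ((T' x : ℂ_[p]) * T' y) ^ q ^ (a * b) = (T' x : ℂ_[p]) * T' y
    rw [mul_pow, e1, e2]
  have hmul : ∀ x y, (T' (x * y) : ℂ_[p]) = T' x * T' y := by
    intro x y
    have h := huniq (hT'mem (x * y)) (hmul_mem x y)
      (by rw [hT'res, map_mul, map_mul, hT'res, hT'res])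
    exact h
  have hone : (T' 1 : ℂ_[p]) = 1 := by
    have h := huniq (hT'mem 1) (ζ' := 1) ⟨1, one_pos, by simp⟩ (by rw [hT'res, map_one, map_one])
    exact h
  have hzero : (T' 0 : ℂ_[p]) = 0 := by
    have hq0 : q ≠ 0 := (lt_trans Nat.zero_lt_one hq1).ne'
    have h := huniq (hT'mem 0) (ζ' := 0) ⟨1, one_pos, by simp [hq0]⟩
      (by rw [hT'res, map_zero, map_zero])
    exact h
  let T : AlgebraicClosure k →* ℂ_[p] :=
    { toFun := fun x => (T' x : ℂ_[p])
      map_one' := hone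
      map_mul' := hmul }
  have hT : ∀ x, T x = (T' x : ℂ_[p]) := fun x => rfl
  refine ⟨T, hzero, fun x => norm_coe_unitBall (T' x), ?_, ?_, ?_, ?_⟩
  · -- injective
    intro x y hxy
    apply hΦinj
    rw [← hT'res x, ← hT'res y]
    congr 1
    exact Subtype.ext hxy
  · -- `x^{qˢ} = x ⟹ (T x)^{qˢ} = T x`
    intro s x hx
    rcases Nat.eq_zero_or_pos s with rfl | hs
    · rw [pow_zero, pow_one]
    obtain ⟨a, ha, hxa⟩ := hT'mem x
    have hmem : ∃ s', 0 < s' ∧ (((T' x) ^ q ^ s : 𝓞_ℂ_[p]) : ℂ_[p]) ^ q ^ s' = ((T' x) ^ q ^ s : 𝓞_ℂ_[p]) := by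
      refine ⟨a, ha, ?_⟩
      change ((T' x : ℂ_[p]) ^ q ^ s) ^ q ^ a = (T' x : ℂ_[p]) ^ q ^ s
      rw [← pow_mul, mul_comm, pow_mul, hxa]
    have h := huniq hmem (hT'mem x) (by rw [map_pow, hT'res, ← map_pow, hx])
    exact h
  · -- surjectivity onto `μ_{qˢ-1}`
    intro s hs y hy
    haveI : NeZero s := ⟨hs.ne'⟩
    have hqs : 1 < q ^ s := by
      calc 1 < q := hq1
        _ = q ^ 1 := (pow_one q).symm
        _ ≤ q ^ s := Nat.pow_le_pow_right (by omega) hs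
    have hyE : y ^ q ^ s = y := by
      conv_lhs => rw [← Nat.sub_add_cancel hqs.le, pow_succ, hy, one_mul]
    have hy1 : ‖y‖ ≤ 1 := by
      have := congrArg norm hy
      rw [norm_pow, norm_one] at this
      exact ((pow_eq_one_iff_of_nonneg (norm_nonneg y) (by omega)).mp this).le
    set ζ : 𝓞_ℂ_[p] := ⟨y, mem_padicComplexInt_iff.mpr hy1⟩ with hζ
    -- the residue of `y` is `Φ x` for some `x ∈ 𝔽_{qˢ}`
    have hres : (IsLocalRing.residue 𝓞_ℂ_[p] ζ) ^ Nat.card (fixedField k s) =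
        IsLocalRing.residue 𝓞_ℂ_[p] ζ := by
      rw [Nat.card_eq_fintype_card, card_fixedField, ← map_pow]
      congr 1
      exact Subtype.ext hyE
    obtain ⟨x, hx⟩ := Literature.AlgebraicGeometry.Motives.mem_range_of_pow_card_eq
      (Φ.comp (fixedField k s).subtype) hres
    refine ⟨(x : AlgebraicClosure k), x.2, ?_⟩
    rw [hT]
    exact huniq (ζ' := ζ) (hT'mem x) ⟨s, hs, hyE⟩ ((hT'res _).trans hx)
  · -- the trace congruence
    intro s _ _ y
    have hcard : Fintype.card (fixedField k s) = p ^ (r * s) := by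
      rw [card_fixedField, ← hq, hr, ← pow_mul]
    have htr := algebraMap_trace_eq_sum_pow_of_card hcard y
    set t := Algebra.trace (ZMod p) (fixedField k s) y with ht
    -- read the identity in `κ` through `Φ' = Φ|_{𝔽_{qˢ}}`
    set Φ' : fixedField k s →+* IsLocalRing.ResidueField 𝓞_ℂ_[p] := Φ.comp (fixedField k s).subtype
      with hΦ'
    have hres' : IsLocalRing.residue 𝓞_ℂ_[p] (T' y) = Φ' y := hT'res y
    have h1 : ∑ i ∈ range (r * s), Φ' y ^ p ^ i = (t.val : IsLocalRing.ResidueField 𝓞_ℂ_[p]) := by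
      have h := congrArg Φ' htr
      rw [map_sum] at h
      simp only [map_pow] at h
      rw [← h, ← ZMod.natCast_zmod_val t, map_natCast, map_natCast, ZMod.natCast_zmod_val]
    have hZ : IsLocalRing.residue 𝓞_ℂ_[p]
        (∑ i ∈ range (r * s), T' y ^ p ^ i - (t.val : 𝓞_ℂ_[p])) = 0 := by
      rw [map_sub, map_sum, map_natCast]
      simp only [map_pow, hres']
      rw [h1, sub_self]
    have hlt := (residue_eq_zero_iff' _).mp hZ
    have hcoe : (((∑ i ∈ range (r * s), T' y ^ p ^ i - (t.val : 𝓞_ℂ_[p]) : 𝓞_ℂ_[p])) : ℂ_[p]) =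
        ∑ i ∈ range (r * s), T y ^ p ^ i - (t.val : ℂ_[p]) := by
      rw [AddSubgroupClass.coe_sub, AddSubmonoidClass.coe_finsetSum, SubringClass.coe_natCast]
      simp only [SubmonoidClass.coe_pow, hT]
    rwa [hcoe] at hlt

end Dwork

end Literature.NumberTheory.LFunctions
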